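import Literature.MathematicalPhysics.QuantumFieldTheory.Balaban1983to89.B15SU2ChartHolomorphic
import Literature.MathematicalPhysics.QuantumFieldTheory.Balaban1983to89.T4CubeChartExp

/-!
# (GR-b′) organ lemmas (ii′)+(iii′): the chart is ODD-TO-INVERSE and every SU(2) element is SU(2)-conjugate to its inverse — (ii′): the one-bond exponential chart is ODD-TO-INVERSE, `expPt (−v) = (expPt v)⁻¹`

`CURRENCY-MEMO-g26.md` §10.6 (ii′).  Via the matrix dictionary ✓`B15SU2ChartHolomorphic.coe_expPoint_eq_expPointC` (`↑(expPoint x) = expPointC x̂`,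
`expPointC z = exp (Σ z_a • E_a)`) and `Matrix.exp_neg`; the SU(2) inverse is the adjoint (`rfl`), which equals the matrix inverse by unitarity.
Together with `SU2ConjInv.su2_exists_conj_eq_inv` (every `g : SU2` is SU2-conjugate to `g⁻¹`) this gives: the excitation by `−v` is a GLOBAL GAUGE
CONJUGATE of the excitation by `v` — the input of `GREven.fderiv_zero_of_even`.  HONEST: chart bookkeeping; nothing about the runs; R3 = SU(2) YM₃ on T³ —
NOT d = 4, NOT infinite volume, NOT a mass gap, NOT Clay.
-/

/-! ### Local copy of `SU2ConjInv` (HOME file `SU2ConjInv.lean`, restated BY TEXT so this file is self-contained) -/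

namespace Summit.QuantumFields.YangMills.Cruxes.FluctuationComparisonRegPrIntL.ExpPtNeg.SU2ConjInvLocal

open Matrix ComplexConjugate

/-- Entry relations of a special unitary 2×2 matrix: `M 1 1 = conj (M 0 0)` and `M 1 0 = - conj (M 0 1)`. -/
theorem su2_entries (M : Matrix (Fin 2) (Fin 2) ℂ) (hU : M * star M = 1) (hdet : M.det = 1) :
    M 1 1 = conj (M 0 0) ∧ M 1 0 = -conj (M 0 1) := by
  have hinv : M⁻¹ = star M := Matrix.inv_eq_right_inv hU
  have hadj : M⁻¹ = M.adjugate := by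
    rw [Matrix.inv_def, hdet]; simp
  have hstar : star M = M.adjugate := by rw [← hinv, hadj]
  have h11 : (star M) 0 0 = M.adjugate 0 0 := by rw [hstar]
  have h10 : (star M) 1 0 = M.adjugate 1 0 := by rw [hstar]
  rw [Matrix.adjugate_fin_two] at h11 h10
  simp [Matrix.star_apply] at h11 h10
  constructor
  · rw [← h11]
  · rw [h10]; ring

/-- The witness computation, abstracted: `H = !![0, c; -conj c, 0]` with `c·conj c = 1`, `c²·conj b = −b` conjugates `M = !![a, b; -conj b, conj a]` to `star M`. -/
theorem conj_witness (M : Matrix (Fin 2) (Fin 2) ℂ) (h11 : M 1 1 = conj (M 0 0)) (h10 : M 1 0 = -conj (M 0 1)) (c : ℂ)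
    (hc : c * conj c = 1) (hc2 : c * c * conj (M 0 1) = -M 0 1) (hc3 : conj c * conj c * M 0 1 = -conj (M 0 1)) :
    (!![0, c; -conj c, 0] : Matrix (Fin 2) (Fin 2) ℂ) * star (!![0, c; -conj c, 0] : Matrix (Fin 2) (Fin 2) ℂ) = 1 ∧
    Matrix.det (!![0, c; -conj c, 0] : Matrix (Fin 2) (Fin 2) ℂ) = 1 ∧
    (!![0, c; -conj c, 0] : Matrix (Fin 2) (Fin 2) ℂ) * M * star (!![0, c; -conj c, 0] : Matrix (Fin 2) (Fin 2) ℂ) = star M := by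
  refine ⟨?_, ?_, ?_⟩
  · ext i j
    simp only [Matrix.mul_apply, Fin.sum_univ_two, Matrix.star_eq_conjTranspose, Matrix.conjTranspose_apply]
    fin_cases i <;> fin_cases j <;> simp <;> linear_combination hc
  · simp [Matrix.det_fin_two]; linear_combination hc
  · ext i j
    simp only [Matrix.mul_apply, Fin.sum_univ_two, Matrix.star_eq_conjTranspose, Matrix.conjTranspose_apply]
    fin_cases i <;> fin_cases j <;> simp [h11, h10]
    · linear_combination (conj (M 0 0)) * hc
    · linear_combination hc2
    · linear_combination (-1 : ℂ) * hc3
    · linear_combination (M 0 0) * hc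

/-- ★ Every special unitary 2×2 matrix is conjugate, by a special unitary matrix, to its adjoint (= inverse). -/
theorem su2_conj_to_star (M : Matrix (Fin 2) (Fin 2) ℂ) (hU : M * star M = 1) (hdet : M.det = 1) :
    ∃ H : Matrix (Fin 2) (Fin 2) ℂ, H * star H = 1 ∧ H.det = 1 ∧ H * M * star H = star M := by
  obtain ⟨h11, h10⟩ := su2_entries M hU hdet
  by_cases hb : M 0 1 = 0
  · -- diagonal case: c = 1
    refine ⟨!![0, 1; -conj 1, 0], conj_witness M h11 h10 1 (by simp) (by simp [hb]) (by simp [hb])⟩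
  · set b : ℂ := M 0 1 with hbdef
    set n : ℝ := ‖b‖ with hndef
    have hn : n ≠ 0 := by rw [hndef]; exact norm_ne_zero_iff.mpr hb
    have hnC : (n : ℂ) ≠ 0 := by exact_mod_cast hn
    have hbb : b * conj b = ((n : ℂ)) ^ 2 := by
      rw [Complex.mul_conj, hndef, Complex.normSq_eq_norm_sq]; push_cast; ring
    set c : ℂ := Complex.I * b / n with hcdef
    have hconjc : conj c = -(Complex.I * conj b / n) := by
      rw [hcdef]; simp [map_div₀, map_mul, Complex.conj_I, Complex.conj_ofReal]; ring
    have hc : c * conj c = 1 := by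
      rw [hconjc, hcdef]
      have : Complex.I * b / ↑n * -(Complex.I * conj b / ↑n) = -(Complex.I * Complex.I) * (b * conj b) / (n : ℂ) ^ 2 := by ring
      rw [this, Complex.I_mul_I, hbb]; field_simp
    have hc2 : c * c * conj b = -b := by
      rw [hcdef]
      have : Complex.I * b / ↑n * (Complex.I * b / ↑n) * conj b = (Complex.I * Complex.I) * b * (b * conj b) / (n : ℂ) ^ 2 := by ring
      rw [this, Complex.I_mul_I, hbb]; field_simp
    have hc3 : conj c * conj c * b = -conj b := by
      have := congrArg conj hc2
      simpa [map_mul, map_neg] using this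
    exact ⟨!![0, c; -conj c, 0], conj_witness M h11 h10 c hc hc2 hc3⟩

/-- ★★ GROUP-LEVEL FORM, as the organ needs it (`SU2 := ↥(Matrix.specialUnitaryGroup (Fin 2) ℂ)`): every element of SU(2) is conjugate IN SU(2) to its inverse —
so the one-bond excitation by `−v` (= the inverse of `expPt v`, lemma (ii′)) is a GLOBAL GAUGE CONJUGATE of the excitation by `v`. -/
theorem su2_exists_conj_eq_inv (g : Matrix.specialUnitaryGroup (Fin 2) ℂ) :
    ∃ h : Matrix.specialUnitaryGroup (Fin 2) ℂ, h * g * h⁻¹ = g⁻¹ := by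
  have hg := Matrix.mem_specialUnitaryGroup_iff.1 g.2
  have hU : (g : Matrix (Fin 2) (Fin 2) ℂ) * star (g : Matrix (Fin 2) (Fin 2) ℂ) = 1 := Matrix.mem_unitaryGroup_iff.1 hg.1
  obtain ⟨H, hH1, hH2, hH3⟩ := su2_conj_to_star (g : Matrix (Fin 2) (Fin 2) ℂ) hU hg.2
  have hHmem : H ∈ Matrix.specialUnitaryGroup (Fin 2) ℂ :=
    Matrix.mem_specialUnitaryGroup_iff.2 ⟨Matrix.mem_unitaryGroup_iff.2 hH1, hH2⟩
  refine ⟨⟨H, hHmem⟩, ?_⟩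
  apply Subtype.ext
  exact hH3

end Summit.QuantumFields.YangMills.Cruxes.FluctuationComparisonRegPrIntL.ExpPtNeg.SU2ConjInvLocal

namespace Summit.QuantumFields.YangMills.Cruxes.FluctuationComparisonRegPrIntL.ExpPtNeg

open Literature.MathematicalPhysics.QuantumFieldTheory.Balaban1983to89
open B15SU2ChartHolomorphic (expPointC coe_expPoint_eq_expPointC genE)
open T4HaarSU2ExpChart (expPoint)
open T4CubeChartExp (expPt toE)
open NormedSpace (exp)

/-- `expPointC (−z) = (expPointC z)⁻¹` (`e^{−M} = (e^{M})⁻¹`). -/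
theorem expPointC_neg (z : EuclideanSpace ℂ (Fin 3)) : expPointC (-z) = (expPointC z)⁻¹ := by
  rw [expPointC, expPointC, ← Matrix.exp_neg]
  congr 1
  rw [← Finset.sum_neg_distrib]
  refine Finset.sum_congr rfl fun a _ => ?_
  simp [neg_smul]

/-- In `SU(2)` the inverse, read in matrices, is the matrix inverse. -/
theorem coe_inv_eq_matrix_inv (g : Matrix.specialUnitaryGroup (Fin 2) ℂ) :
    ((g⁻¹ : Matrix.specialUnitaryGroup (Fin 2) ℂ) : Matrix (Fin 2) (Fin 2) ℂ) = (g : Matrix (Fin 2) (Fin 2) ℂ)⁻¹ := by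
  have hU : (g : Matrix (Fin 2) (Fin 2) ℂ) * star (g : Matrix (Fin 2) (Fin 2) ℂ) = 1 :=
    Matrix.mem_unitaryGroup_iff.1 (Matrix.mem_specialUnitaryGroup_iff.1 g.2).1
  rw [Matrix.inv_eq_right_inv hU]
  rfl

/-- ★ (ii′) `expPoint (−x) = (expPoint x)⁻¹` in `SU(2)`. -/
theorem expPoint_neg (x : EuclideanSpace ℝ (Fin 3)) : expPoint (-x) = (expPoint x)⁻¹ := by
  apply Subtype.ext
  rw [coe_inv_eq_matrix_inv, coe_expPoint_eq_expPointC, coe_expPoint_eq_expPointC, ← expPointC_neg]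
  congr 1
  ext a
  simp

/-- ★ (ii′) for coordinate vectors: `expPt (−v) = (expPt v)⁻¹`. -/
theorem expPt_neg (v : Fin 3 → ℝ) : expPt (-v) = (expPt v)⁻¹ := by
  rw [expPt, expPt, ← expPoint_neg]
  rfl

/-- ★★ THE EXCITATION BY `−v` IS A GLOBAL GAUGE CONJUGATE OF THE EXCITATION BY `v`: `∃ h : SU2, h * expPt v * h⁻¹ = expPt (−v)`
(with `h * 1 * h⁻¹ = 1` on every other bond, a constant gauge transformation maps the one-bond excitation `W(v)` to `W(−v)`). -/
theorem exists_conj_expPt_eq_expPt_neg (v : Fin 3 → ℝ) :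
    ∃ h : Matrix.specialUnitaryGroup (Fin 2) ℂ, h * expPt v * h⁻¹ = expPt (-v) := by
  obtain ⟨h, hh⟩ := SU2ConjInvLocal.su2_exists_conj_eq_inv (expPt v)
  exact ⟨h, by rw [hh, expPt_neg]⟩

end Summit.QuantumFields.YangMills.Cruxes.FluctuationComparisonRegPrIntL.ExpPtNeg
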